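import Summits.CriticalPhenomena.Ising3DConformalLimit.Theses.BernsteinTemperature
import HarnessLib

/-!
# Birth skeleton (BC3) — crux `KernelLocalLimit` (item stmt-CriticalPhenomena-8358)
# route-CriticalPhenomena-BernsteinTemperature, sub-problem `Ising3DConformalLimit`

The crux: for every non-negative HT coefficient family `a : ℤ³ × ℕ → ℝ` representing the plus-state
two-point functions below `β_c(3)` as in `AbsMonotoneTanh` (hypotheses H0 nonnegativity, H1
support/parity, H2 `HasSum` representation), there are `ν γ C A p Q` with the twelve clauses
P1 `0 < ν`, P2 `γ < 3ν`, P3 `0 < C`, P4 `0 < A`, P5 `3 − γ/ν < p`, P6 `Q` continuous on `[0,∞)`,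
P7 `Q ≥ 0`, P8 `Q > 0` somewhere, P9 `Σ_y a_n(y) < ∞`, P10 pure-power regular variation
`tanhⁿβ_c · Σ_y a_n(y) / n^{γ−1} → C`, P11 isotropic local limit with profile `Q` and spread
exponent `ν`, P12 polynomial tail bound.

The line (the route header's own TWO-LAYER PLAN for this crux, `SusceptibilityRegularVariation →
KernelScalingGivenRV → KernelLocalLimit`, with the second child cut once more along the crux's
`why it might fail` anatomy "pure-power s_n / RADIAL local limit / polynomial tails, ONE shared ν"):

* `stub_susceptibilityRV`      (S) — existence of the susceptibility exponent `γ` as a PURE POWER: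
  `∃ γ C, 0 < C ∧ P10(γ, C)` (regular variation of the susceptibility HT coefficients
  `s_n = v_cⁿ Σ_y a_n(y)`, no logarithmic / confluent drift surviving in the limit).
* `stub_isotropicLocalLimit`   (L) — the RADIAL local limit theorem of the fixed-order HT kernels:
  `∃ ν Q, 0 < ν ∧ P6 ∧ P7 ∧ P8 ∧ P11(ν, Q)` (cubic anisotropy of `q_n = a_n/Σa_n` dies in the
  scaling window `|x|₂ ≍ n^ν`; the load-bearing stub — isotropy of the summit's clause (ii) at the
  two-point level enters the route here).
* `stub_hyperscalingTails`     (T) — given THE `(γ, C)` of (S) and THE `(ν, Q)` of (L) (both are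
  pinned: `C > 0` fixes `γ`; `Q` continuous, `≥ 0`, positive somewhere fixes `ν`), the exponent
  window `γ < 3ν` (i.e. `2Δ = 3 − γ/ν > 0`, Fisher) and a polynomial tail of order `p > 3 − γ/ν`:
  `∃ A p, P2 ∧ P4 ∧ P5 ∧ P12(ν, A, p)`.

Glue proved here (no sorry): P9 from H1 alone (for fixed `n` the support `{y : |y|₁ ≤ n}` is
finite: `summable_of_support`), and the assembly `KernelLocalLimit_of : KernelLocalLimit`
(= (S) → (L) → (T) → crux, concluding the route decl BY NAME).

Disproof used: none relevant (no `Disproof.lean` / Negative lemma exists on this crux at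
registration time, `ledger crux ls stmt-CriticalPhenomena-8358` 2026-08-17).
Sources: route header (BernsteinTemperature, TWO-LAYER PLAN; Fisher1967, CampostriniEtAl1998,
ButeraComi2002, FisherBurford1967, DuminilCopinICM2022).
-/

namespace Summit.CriticalPhenomena.Ising3DConformalLimit.Cruxes.KernelLocalLimit.Birth

open Literature.Probability.LatticeModels Filter
open Summit.CriticalPhenomena.Ising3DConformalLimit.Theses.BernsteinTemperature (KernelLocalLimit)

/-! ## Stubs (the only `sorry`s of this file) -/

/-- **Stub (S) — susceptibility regular variation with a pure power.** For every HT coefficient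
family `a` as in the crux, the susceptibility coefficients `s_n = tanhⁿβ_c(3) · Σ_y a_n(y)` satisfy
`s_n / n^{γ−1} → C > 0` for some `γ` (existence of `γ` on `ℤ³` as a pure power; OPEN). -/
theorem stub_susceptibilityRV :
    ∀ a : Site 3 → ℕ → ℝ, (∀ x n, 0 ≤ a x n) →
      (∀ x n, (n < ∑ i, (x i).natAbs ∨ ¬ Even (n + ∑ i, (x i).natAbs)) → a x n = 0) →
      (∀ (x : Site 3) (β : ℝ), 0 ≤ β → β < criticalBeta 3 →
        HasSum (fun n => a x n * Real.tanh β ^ n) (twoPointPlus 3 β x)) →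
      ∃ γ C : ℝ, 0 < C ∧
        Tendsto (fun n : ℕ => Real.tanh (criticalBeta 3) ^ n * (∑' y : Site 3, a y n) /
          (n : ℝ) ^ (γ - 1)) atTop (nhds C) := by
  sorry

/-- **Stub (L) — isotropic (radial) local limit of the fixed-order HT kernels.** For every HT
coefficient family `a` as in the crux there are a spread exponent `ν > 0` and a profile `Q`,
continuous and `≥ 0` on `[0,∞)` and positive somewhere, with
`sup_{|x|₂ ≤ R n^ν, n ≡ |x|₁ (2)} |n^{3ν} a_n(x) / (2 Σ_y a_n(y)) − Q(|x|₂/n^ν)| → 0` for every `R`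
(OPEN; the load-bearing stub: rotation invariance at the two-point level, organised by expansion
order). -/
theorem stub_isotropicLocalLimit :
    ∀ a : Site 3 → ℕ → ℝ, (∀ x n, 0 ≤ a x n) →
      (∀ x n, (n < ∑ i, (x i).natAbs ∨ ¬ Even (n + ∑ i, (x i).natAbs)) → a x n = 0) →
      (∀ (x : Site 3) (β : ℝ), 0 ≤ β → β < criticalBeta 3 →
        HasSum (fun n => a x n * Real.tanh β ^ n) (twoPointPlus 3 β x)) →
      ∃ (ν : ℝ) (Q : ℝ → ℝ), 0 < ν ∧ ContinuousOn Q (Set.Ici 0) ∧ (∀ r, 0 ≤ r → 0 ≤ Q r) ∧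
        (∃ r, 0 ≤ r ∧ 0 < Q r) ∧
        (∀ R ε : ℝ, 0 < R → 0 < ε → ∀ᶠ n : ℕ in Filter.atTop, ∀ x : Site 3,
          Real.sqrt (∑ i, ((x i : ℝ)) ^ 2) ≤ R * (n : ℝ) ^ ν → Even (n + ∑ i, (x i).natAbs) →
          |(n : ℝ) ^ (3 * ν) * a x n / (2 * ∑' y : Site 3, a y n) -
            Q (Real.sqrt (∑ i, ((x i : ℝ)) ^ 2) / (n : ℝ) ^ ν)| ≤ ε) := by
  sorry

/-- **Stub (T) — exponent window and polynomial tails, given the data of (S) and (L).** For every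
HT coefficient family `a` as in the crux, every `(γ, C)` with `C > 0` and pure-power regular
variation of the susceptibility coefficients, and every `(ν, Q)` with `ν > 0`, `Q` continuous and
`≥ 0` on `[0,∞)`, positive somewhere, realising the isotropic local limit: `γ < 3ν` (i.e.
`2Δ = 3 − γ/ν > 0`) and the kernels have a polynomial tail of some order `p > 3 − γ/ν`,
`n^{3ν} a_n(x)/Σ_y a_n(y) ≤ A (1 + |x|₂/n^ν)^{−p}` for `n ≥ 1` (OPEN; conjecturally the tails are
stretched-exponential, so every `p` should do). -/
theorem stub_hyperscalingTails :
    ∀ a : Site 3 → ℕ → ℝ, (∀ x n, 0 ≤ a x n) →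
      (∀ x n, (n < ∑ i, (x i).natAbs ∨ ¬ Even (n + ∑ i, (x i).natAbs)) → a x n = 0) →
      (∀ (x : Site 3) (β : ℝ), 0 ≤ β → β < criticalBeta 3 →
        HasSum (fun n => a x n * Real.tanh β ^ n) (twoPointPlus 3 β x)) →
      ∀ (ν γ C : ℝ) (Q : ℝ → ℝ), 0 < ν → 0 < C → ContinuousOn Q (Set.Ici 0) →
        (∀ r, 0 ≤ r → 0 ≤ Q r) → (∃ r, 0 ≤ r ∧ 0 < Q r) →
        Tendsto (fun n : ℕ => Real.tanh (criticalBeta 3) ^ n * (∑' y : Site 3, a y n) /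
          (n : ℝ) ^ (γ - 1)) atTop (nhds C) →
        (∀ R ε : ℝ, 0 < R → 0 < ε → ∀ᶠ n : ℕ in Filter.atTop, ∀ x : Site 3,
          Real.sqrt (∑ i, ((x i : ℝ)) ^ 2) ≤ R * (n : ℝ) ^ ν → Even (n + ∑ i, (x i).natAbs) →
          |(n : ℝ) ^ (3 * ν) * a x n / (2 * ∑' y : Site 3, a y n) -
            Q (Real.sqrt (∑ i, ((x i : ℝ)) ^ 2) / (n : ℝ) ^ ν)| ≤ ε) →
        ∃ A p : ℝ, γ < 3 * ν ∧ 0 < A ∧ 3 - γ / ν < p ∧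
          (∀ (x : Site 3) (n : ℕ), 1 ≤ n →
            (n : ℝ) ^ (3 * ν) * a x n / (∑' y : Site 3, a y n) ≤
              A * (1 + Real.sqrt (∑ i, ((x i : ℝ)) ^ 2) / (n : ℝ) ^ ν) ^ (-p)) := by
  sorry

/-! ## Glue (no `sorry` below this line) -/

/-- P9 of the crux from H1 alone: for fixed `n` the coefficients `y ↦ a_n(y)` vanish off the finite
box `[-n, n]³ ⊇ {y : |y|₁ ≤ n}`, hence are summable. -/
theorem summable_of_support {a : Site 3 → ℕ → ℝ}
    (h : ∀ x n, (n < ∑ i, (x i).natAbs ∨ ¬ Even (n + ∑ i, (x i).natAbs)) → a x n = 0) (n : ℕ) :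
    Summable (fun y : Site 3 => a y n) := by
  refine summable_of_ne_finset_zero
    (s := Fintype.piFinset fun _ : Fin 3 => Finset.Icc (-(n : ℤ)) n) ?_
  intro y hy
  refine h y n (Or.inl ?_)
  have hex : ∃ i, y i ∉ Finset.Icc (-(n : ℤ)) n := by
    by_contra hcon
    exact hy (Fintype.mem_piFinset.2 fun i => not_not.mp (not_exists.mp hcon i))
  obtain ⟨i, hi⟩ := hex
  rw [Finset.mem_Icc, not_and_or, not_le, not_le] at hi
  have h1 : n < (y i).natAbs := by omega
  exact lt_of_lt_of_le h1
    (Finset.single_le_sum (f := fun j => (y j).natAbs) (fun j _ => Nat.zero_le _)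
      (Finset.mem_univ i))

/-- **Assembly — the crux BY NAME from the three stubs** (`(S) → (L) → (T) → KernelLocalLimit`):
`(γ, C)` from (S), `(ν, Q)` from (L), `(A, p)` and `γ < 3ν` from (T) fed with both, P9 from
`summable_of_support`; then the twelve clauses are reassembled in the crux's order. The `sorry`s in
its closure are exactly `stub_susceptibilityRV`, `stub_isotropicLocalLimit`,
`stub_hyperscalingTails`. -/
theorem KernelLocalLimit_of : KernelLocalLimit := by
  intro a h0 h1 h2
  obtain ⟨γ, C, hC, hRV⟩ := stub_susceptibilityRV a h0 h1 h2
  obtain ⟨ν, Q, hν, hQc, hQ0, hQpos, hLL⟩ := stub_isotropicLocalLimit a h0 h1 h2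
  obtain ⟨A, p, hγν, hA, hp, hT⟩ :=
    stub_hyperscalingTails a h0 h1 h2 ν γ C Q hν hC hQc hQ0 hQpos hRV hLL
  exact ⟨ν, γ, C, A, p, Q, hν, hγν, hC, hA, hp, hQc, hQ0, hQpos,
    fun n => summable_of_support h1 n, hRV, hLL, hT⟩

end Summit.CriticalPhenomena.Ising3DConformalLimit.Cruxes.KernelLocalLimit.Birth
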